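import Summits.Ventures.PercRepro.ProfilePointedUniformRestrictionLine

/-!
# PercRepro — THE ODD CASE: THE PROFILE SPLITS OFF A `U_{s+1,2s+1}`-RESTRICTION AS A SUM OVER ITS `s`-SUBSETS
(p10, gen 24; unconditional)

Let `L ⊆ E` be a `U_{s+1,2s+1}`-restriction of `N`: `#L = 2s + 1`, `ρ(L) = s + 1`, every `(s+1)`-subset of `L`
independent (`OddRestriction`; `s = 1`: a 3-point line).  A bi-independent set meets `L` in `s` or `s + 1` elements
(`card_inter_eq_or_of_mem_biIndepSets`: the two traces are independent subsets of `L` partitioning it).  For an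
`s`-subset `T₀ ⊆ L` and a point `f ∈ L ∖ T₀` let `M(T₀, f) := N / T₀ ∖ (L ∖ T₀ ∖ {f})` (`oddMinor`), a matroid on
`E ∖ (L ∖ {f})` — `2s` fewer elements.  For `Z ⊆ E ∖ L`: `Z ∪ T₀` is bi-independent in `N` iff `Z` is bi-independent in
`M(T₀, f)` (`union_mem_biIndepSets_odd_low_iff`: an `(s+1)`-subset of `L` spans `L`, so the complement's trace `L ∖ T₀`
may be traded for `T₀ ∪ {f}` — `rk_union_eq_of_rk_eq`), and `Z ∪ (L ∖ T₀)` is bi-independent in `N` iff `Z ∪ {f}` is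
bi-independent in `M(T₀, f)` (`union_mem_biIndepSets_odd_high_iff`).  Hence the bi-independent `k`-sets of `N` with
trace `T₀` are the bi-independent `(k−s)`-sets of `M(T₀, f)` avoiding `f` (`card_filter_biIndepSets_odd_low`), those
with trace `L ∖ T₀` are the ones through `f` (`card_filter_biIndepSets_odd_high`), and summing over the `s`-subsets `T₀`
(every trace is some `T₀` or some `L ∖ T₀`):  `P_k(N) = Σ_{T₀} P_{k−s}(M(T₀, f T₀))` (`card_biIndepSets_odd`) for any
choice `f T₀ ∈ L ∖ T₀`; `P_k(N) = 0` for `k < s` (`card_biIndepSets_odd_eq_zero_of_lt`).  The extension counts and the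
(Ĉ)-transfers follow in ProfilePointedUnifOddExt / ProfilePointedUnifOddRow.  Nothing here asserts (Ĉ).
-/

open scoped Matroid

namespace PercRepro.Cogirth

open Finset ThmH Skew

variable {α : Type} [DecidableEq α] {N : Matroid α} [N.Finite]

/-- **A `U_{s+1,2s+1}`-restriction** of `N`: `L ⊆ E`, `#L = 2s + 1`, `ρ(L) = s + 1`, every `(s+1)`-subset of `L`
independent (`s = 1`: a 3-point line). -/
structure OddRestriction (N : Matroid α) [N.Finite] (L : Finset α) (s : ℕ) : Prop where
  subset_gr : L ⊆ gr N
  card_eq : L.card = 2 * s + 1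
  rk_eq : rk N L = s + 1
  rk_sub : ∀ T ∈ L.powersetCard (s + 1), rk N T = s + 1

/-- The minor `M(T₀, f) = N / T₀ ∖ (L ∖ T₀ ∖ {f})`: contract the `s`-subset `T₀` of `L`, delete the rest of `L` except
`f`. -/
noncomputable abbrev oddMinor (N : Matroid α) (L T₀ : Finset α) (f : α) : Matroid α :=
  N ／ (T₀ : Set α) ＼ (((L \ T₀).erase f : Finset α) : Set α)

section odd

variable {L : Finset α} {s : ℕ}

/-- Independence in a contraction-deletion minor: for `T` independent and `Z` disjoint from `T` and from `D`, `Z` is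
independent in `N / T ∖ D` iff `Z ∪ T` is independent in `N`. -/
theorem rk_contract_delete_eq_card_iff' {T D Z : Finset α} (hT : rk N T = T.card) (hZT : Disjoint Z T)
    (hZD : Disjoint Z D) :
    rk (N ／ (T : Set α) ＼ (D : Set α)) Z = Z.card ↔ rk N (Z ∪ T) = (Z ∪ T).card := by
  have hTi : N.Indep (T : Set α) := indep_of_rk_eq_card' hT
  constructor
  · intro h
    have h1 := indep_of_rk_eq_card' h
    rw [Matroid.delete_indep_iff, hTi.contract_indep_iff] at h1
    obtain ⟨⟨-, h2⟩, -⟩ := h1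
    rw [← Finset.coe_union] at h2
    exact rk_eq_card_of_indep' h2
  · intro h
    apply rk_eq_card_of_indep'
    rw [Matroid.delete_indep_iff, hTi.contract_indep_iff]
    refine ⟨⟨Finset.disjoint_coe.2 hZT, ?_⟩, Finset.disjoint_coe.2 hZD⟩
    rw [← Finset.coe_union]
    exact indep_of_rk_eq_card' h

/-- The ground finset of `M(T₀, f)` is `E ∖ (L ∖ {f})`. -/
theorem gr_oddMinor {T₀ : Finset α} (hT₀ : T₀ ⊆ L) {f : α} (hfT : f ∉ T₀) :
    gr (oddMinor N L T₀ f) = gr N \ L.erase f := by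
  apply Finset.coe_injective
  rw [coe_gr, Matroid.delete_ground, Matroid.contract_ground, Finset.coe_sdiff, coe_gr, Set.sdiff_sdiff,
    ← Finset.coe_union]
  congr 1
  rw [Finset.coe_inj]
  ext x
  constructor
  · intro hx
    rcases mem_union.1 hx with hx | hx
    · exact mem_erase.2 ⟨fun h => hfT (h ▸ hx), hT₀ hx⟩
    · exact mem_erase.2 ⟨(mem_erase.1 hx).1, (mem_sdiff.1 (mem_erase.1 hx).2).1⟩
  · intro hx
    obtain ⟨hxf, hxL⟩ := mem_erase.1 hx
    by_cases hxT : x ∈ T₀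
    · exact mem_union_left _ hxT
    · exact mem_union_right _ (mem_erase.2 ⟨hxf, mem_sdiff.2 ⟨hxL, hxT⟩⟩)

omit [DecidableEq α] in
/-- Every `s`-subset of `L` is independent (it lies in an `(s+1)`-subset). -/
theorem rk_sub_eq_card (hL : OddRestriction N L s) {T₀ : Finset α} (hT₀ : T₀ ∈ L.powersetCard s) :
    rk N T₀ = T₀.card := by
  obtain ⟨hT₀L, hT₀c⟩ := mem_powersetCard.1 hT₀
  obtain ⟨T, hT₀T, hTL, hTc⟩ := exists_subsuperset_card_eq (n := s + 1) hT₀L (by rw [hT₀c]; omega)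
    (by rw [hL.card_eq]; omega)
  have hT : rk N T = T.card := by rw [hTc]; exact hL.rk_sub T (mem_powersetCard.2 ⟨hTL, hTc⟩)
  exact rk_eq_card_of_subset_of_rk_eq_card hT₀T hT

/-- Independence in `M(T₀, f)` for `Z ⊆ E ∖ (L ∖ {f})`: iff `Z ∪ T₀` is independent in `N`. -/
theorem rk_oddMinor_eq_card_iff (hL : OddRestriction N L s) {T₀ : Finset α} (hT₀ : T₀ ∈ L.powersetCard s) {f : α}
    (hfT : f ∉ T₀) {Z : Finset α} (hZ : Z ⊆ gr N \ L.erase f) :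
    rk (oddMinor N L T₀ f) Z = Z.card ↔ rk N (Z ∪ T₀) = (Z ∪ T₀).card := by
  obtain ⟨hT₀L, -⟩ := mem_powersetCard.1 hT₀
  apply rk_contract_delete_eq_card_iff' (rk_sub_eq_card hL hT₀)
  · exact disjoint_left.2 (fun x hx hxT => (mem_sdiff.1 (hZ hx)).2 (mem_erase.2 ⟨fun h => hfT (h ▸ hxT), hT₀L hxT⟩))
  · exact disjoint_left.2 (fun x hx hxD => (mem_sdiff.1 (hZ hx)).2
      (mem_erase.2 ⟨(mem_erase.1 hxD).1, (mem_sdiff.1 (mem_erase.1 hxD).2).1⟩))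

/-- **A bi-independent set meets a `U_{s+1,2s+1}`-restriction in `s` or `s + 1` elements.** -/
theorem card_inter_eq_or_of_mem_biIndepSets (hL : OddRestriction N L s) {k : ℕ} {X : Finset α}
    (hX : X ∈ biIndepSets N k) : (X ∩ L).card = s ∨ (X ∩ L).card = s + 1 := by
  rw [mem_biIndepSets] at hX
  obtain ⟨-, -, hXr, hXc⟩ := hX
  have h1 : (X ∩ L).card ≤ s + 1 := by
    rw [← rk_eq_card_of_subset_of_rk_eq_card inter_subset_left hXr, ← hL.rk_eq]
    exact rk_mono' inter_subset_right
  have h2 : ((gr N \ X) ∩ L).card ≤ s + 1 := by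
    rw [← rk_eq_card_of_subset_of_rk_eq_card inter_subset_left hXc, ← hL.rk_eq]
    exact rk_mono' inter_subset_right
  have h3 := card_inter_add_card_sdiff_inter hL.subset_gr X
  rw [hL.card_eq] at h3
  omega

/-- An `(s+1)`-subset of `L` spans `L`: two of them are interchangeable in every union with a set avoiding `L`. -/
theorem rk_union_eq_card_iff_odd (hL : OddRestriction N L s) {X : Finset α} (hX : Disjoint X L) {T T' : Finset α}
    (hT : T ∈ L.powersetCard (s + 1)) (hT' : T' ∈ L.powersetCard (s + 1)) :
    rk N (X ∪ T) = (X ∪ T).card ↔ rk N (X ∪ T') = (X ∪ T').card := by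
  obtain ⟨hTL, hTc⟩ := mem_powersetCard.1 hT
  obtain ⟨hT'L, hT'c⟩ := mem_powersetCard.1 hT'
  have hXT : Disjoint X T := disjoint_of_subset_right hTL hX
  have hXT' : Disjoint X T' := disjoint_of_subset_right hT'L hX
  rw [rk_union_eq_of_rk_eq hTL (by rw [hL.rk_sub T hT, hL.rk_eq]) hX, card_union_of_disjoint hXT, hTc,
    rk_union_eq_of_rk_eq hT'L (by rw [hL.rk_sub T' hT', hL.rk_eq]) hX, card_union_of_disjoint hXT', hT'c]

/-- No bi-independent set below level `s`. -/
theorem card_biIndepSets_odd_eq_zero_of_lt (hL : OddRestriction N L s) {k : ℕ} (hk : k < s) :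
    (biIndepSets N k).card = 0 := by
  rw [card_eq_zero, eq_empty_iff_forall_notMem]
  intro X hX
  have h1 := card_inter_eq_or_of_mem_biIndepSets hL hX
  have h2 : (X ∩ L).card ≤ X.card := card_le_card inter_subset_left
  rw [(mem_biIndepSets.1 hX).2.1] at h2
  omega

/-! ### Two finset identities -/

/-- `(E ∖ (L ∖ {f})) ∖ Z = ((E ∖ L) ∖ Z) ∪ {f}` for `Z` avoiding `L`, `f ∈ L ∩ E`. -/
theorem sdiff_erase_sdiff_eq {f : α} (hf : f ∈ gr N) (hfL : f ∈ L) {Z : Finset α} (hZL : Disjoint Z L) :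
    (gr N \ L.erase f) \ Z = ((gr N \ L) \ Z) ∪ {f} := by
  ext x
  constructor
  · intro hx
    obtain ⟨hx, hxZ⟩ := mem_sdiff.1 hx
    obtain ⟨hxg, hxL⟩ := mem_sdiff.1 hx
    by_cases hxf : x = f
    · exact mem_union_right _ (mem_singleton.2 hxf)
    · exact mem_union_left _ (mem_sdiff.2 ⟨mem_sdiff.2 ⟨hxg, fun h => hxL (mem_erase.2 ⟨hxf, h⟩)⟩, hxZ⟩)
  · intro hx
    rcases mem_union.1 hx with hx | hx
    · obtain ⟨hx, hxZ⟩ := mem_sdiff.1 hx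
      obtain ⟨hxg, hxL⟩ := mem_sdiff.1 hx
      exact mem_sdiff.2 ⟨mem_sdiff.2 ⟨hxg, fun h => hxL (mem_erase.1 h).2⟩, hxZ⟩
    · rw [mem_singleton] at hx
      subst hx
      exact mem_sdiff.2 ⟨mem_sdiff.2 ⟨hf, fun h => (mem_erase.1 h).1 rfl⟩, disjoint_right.1 hZL hfL⟩

/-- `(E ∖ (L ∖ {f})) ∖ (Z ∪ {f}) = (E ∖ L) ∖ Z` for `Z` avoiding `L`, `f ∈ L`. -/
theorem sdiff_erase_sdiff_insert_eq {f : α} (hfL : f ∈ L) {Z : Finset α} :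
    (gr N \ L.erase f) \ insert f Z = (gr N \ L) \ Z := by
  ext x
  constructor
  · intro hx
    obtain ⟨hx, hxZ⟩ := mem_sdiff.1 hx
    obtain ⟨hxg, hxL⟩ := mem_sdiff.1 hx
    have hxf : x ≠ f := fun h => hxZ (h ▸ mem_insert_self f Z)
    exact mem_sdiff.2 ⟨mem_sdiff.2 ⟨hxg, fun h => hxL (mem_erase.2 ⟨hxf, h⟩)⟩, fun h => hxZ (mem_insert_of_mem h)⟩
  · intro hx
    obtain ⟨hx, hxZ⟩ := mem_sdiff.1 hx
    obtain ⟨hxg, hxL⟩ := mem_sdiff.1 hx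
    refine mem_sdiff.2 ⟨mem_sdiff.2 ⟨hxg, fun h => hxL (mem_erase.1 h).2⟩, fun h => ?_⟩
    rcases mem_insert.1 h with rfl | h
    · exact hxL hfL
    · exact hxZ h

/-- `E ∖ (Z ∪ T) = ((E ∖ L) ∖ Z) ∪ (L ∖ T)` for `Z` avoiding `L` and `T ⊆ L ⊆ E`. -/
theorem sdiff_union_eq_sdiff_sdiff_union (hLg : L ⊆ gr N) {T : Finset α} (hTL : T ⊆ L) {Z : Finset α}
    (hZL : Disjoint Z L) : gr N \ (Z ∪ T) = ((gr N \ L) \ Z) ∪ (L \ T) := by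
  ext x
  constructor
  · intro hx
    obtain ⟨hxg, hxZT⟩ := mem_sdiff.1 hx
    by_cases hxL : x ∈ L
    · exact mem_union_right _ (mem_sdiff.2 ⟨hxL, fun h => hxZT (mem_union_right _ h)⟩)
    · exact mem_union_left _ (mem_sdiff.2 ⟨mem_sdiff.2 ⟨hxg, hxL⟩, fun h => hxZT (mem_union_left _ h)⟩)
  · intro hx
    rcases mem_union.1 hx with hx | hx
    · obtain ⟨hx, hxZ⟩ := mem_sdiff.1 hx
      obtain ⟨hxg, hxL⟩ := mem_sdiff.1 hx
      refine mem_sdiff.2 ⟨hxg, fun h => ?_⟩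
      rcases mem_union.1 h with h | h
      · exact hxZ h
      · exact hxL (hTL h)
    · obtain ⟨hxL, hxT⟩ := mem_sdiff.1 hx
      refine mem_sdiff.2 ⟨hLg hxL, fun h => ?_⟩
      rcases mem_union.1 h with h | h
      · exact disjoint_right.1 hZL hxL h
      · exact hxT h

/-! ### The two fibres -/

/-- **The low fibre, as a membership equivalence**: for `Z ⊆ E ∖ L`, `Z ∪ T₀` is bi-independent in `N` at level `k`
iff `Z` is bi-independent in `M(T₀, f)` at level `k − s`. -/
theorem union_mem_biIndepSets_odd_low_iff (hL : OddRestriction N L s) {T₀ : Finset α}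
    (hT₀ : T₀ ∈ L.powersetCard s) {f : α} (hfL : f ∈ L) (hfT : f ∉ T₀) {k : ℕ} (hk : s ≤ k) {Z : Finset α}
    (hZ : Z ⊆ gr N \ L) :
    Z ∪ T₀ ∈ biIndepSets N k ↔ Z ∈ biIndepSets (oddMinor N L T₀ f) (k - s) := by
  obtain ⟨hT₀L, hT₀c⟩ := mem_powersetCard.1 hT₀
  have hgr := gr_oddMinor (N := N) hT₀L hfT
  have hf : f ∈ gr N := hL.subset_gr hfL
  have hZL : Disjoint Z L := disjoint_left.2 (fun x hx hxL => (mem_sdiff.1 (hZ hx)).2 hxL)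
  have hZg : Z ⊆ gr N \ L.erase f := hZ.trans (sdiff_subset_sdiff (subset_refl _) (erase_subset f L))
  have hLT : L \ T₀ ∈ L.powersetCard (s + 1) :=
    mem_powersetCard.2 ⟨sdiff_subset, by rw [card_sdiff_of_subset hT₀L, hL.card_eq, hT₀c]; omega⟩
  have hTf : insert f T₀ ∈ L.powersetCard (s + 1) :=
    mem_powersetCard.2 ⟨insert_subset hfL hT₀L, by rw [card_insert_of_notMem hfT, hT₀c]⟩
  have hW : Disjoint ((gr N \ L) \ Z) L := disjoint_of_subset_left sdiff_subset sdiff_disjoint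
  have hWg : (gr N \ L) \ Z ∪ {f} ⊆ gr N \ L.erase f := by
    rw [← sdiff_erase_sdiff_eq hf hfL hZL]
    exact sdiff_subset
  rw [mem_biIndepSets, mem_biIndepSets, hgr, sdiff_erase_sdiff_eq hf hfL hZL,
    rk_oddMinor_eq_card_iff hL hT₀ hfT hZg, rk_oddMinor_eq_card_iff hL hT₀ hfT hWg,
    sdiff_union_eq_sdiff_sdiff_union hL.subset_gr hT₀L hZL, union_assoc, singleton_union,
    rk_union_eq_card_iff_odd hL hW hTf hLT, card_union_of_disjoint (disjoint_of_subset_right hT₀L hZL), hT₀c]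
  constructor
  · rintro ⟨-, hk', h1, h2⟩
    exact ⟨hZg, by omega, h1, h2⟩
  · rintro ⟨-, hk', h1, h2⟩
    exact ⟨union_subset (hZ.trans sdiff_subset) (hT₀L.trans hL.subset_gr), by omega, h1, h2⟩

/-- **The high fibre, as a membership equivalence**: for `Z ⊆ E ∖ L`, `Z ∪ (L ∖ T₀)` is bi-independent in `N` at level
`k` iff `Z ∪ {f}` is bi-independent in `M(T₀, f)` at level `k − s`. -/
theorem union_mem_biIndepSets_odd_high_iff (hL : OddRestriction N L s) {T₀ : Finset α}
    (hT₀ : T₀ ∈ L.powersetCard s) {f : α} (hfL : f ∈ L) (hfT : f ∉ T₀) {k : ℕ} (hk : s ≤ k) {Z : Finset α}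
    (hZ : Z ⊆ gr N \ L) :
    Z ∪ (L \ T₀) ∈ biIndepSets N k ↔ insert f Z ∈ biIndepSets (oddMinor N L T₀ f) (k - s) := by
  obtain ⟨hT₀L, hT₀c⟩ := mem_powersetCard.1 hT₀
  have hgr := gr_oddMinor (N := N) hT₀L hfT
  have hf : f ∈ gr N := hL.subset_gr hfL
  have hZL : Disjoint Z L := disjoint_left.2 (fun x hx hxL => (mem_sdiff.1 (hZ hx)).2 hxL)
  have hfZ : f ∉ Z := disjoint_right.1 hZL hfL
  have hZg : insert f Z ⊆ gr N \ L.erase f :=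
    insert_subset (mem_sdiff.2 ⟨hf, fun h => (mem_erase.1 h).1 rfl⟩)
      (hZ.trans (sdiff_subset_sdiff (subset_refl _) (erase_subset f L)))
  have hLT : L \ T₀ ∈ L.powersetCard (s + 1) :=
    mem_powersetCard.2 ⟨sdiff_subset, by rw [card_sdiff_of_subset hT₀L, hL.card_eq, hT₀c]; omega⟩
  have hTf : insert f T₀ ∈ L.powersetCard (s + 1) :=
    mem_powersetCard.2 ⟨insert_subset hfL hT₀L, by rw [card_insert_of_notMem hfT, hT₀c]⟩
  have hWg : (gr N \ L) \ Z ⊆ gr N \ L.erase f := by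
    rw [← sdiff_erase_sdiff_insert_eq hfL]
    exact sdiff_subset
  have e1 : insert f Z ∪ T₀ = Z ∪ insert f T₀ := by
    ext x
    simp only [mem_union, mem_insert]
    tauto
  rw [mem_biIndepSets, mem_biIndepSets, hgr, sdiff_erase_sdiff_insert_eq hfL,
    rk_oddMinor_eq_card_iff hL hT₀ hfT hZg, rk_oddMinor_eq_card_iff hL hT₀ hfT hWg,
    sdiff_union_eq_sdiff_sdiff_union hL.subset_gr sdiff_subset hZL, Finset.sdiff_sdiff_eq_self hT₀L, e1,
    rk_union_eq_card_iff_odd hL hZL hTf hLT, card_insert_of_notMem hfZ,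
    card_union_of_disjoint (disjoint_of_subset_right sdiff_subset hZL), card_sdiff_of_subset hT₀L, hL.card_eq,
    hT₀c]
  constructor
  · rintro ⟨-, hk', h1, h2⟩
    exact ⟨hZg, by omega, h1, h2⟩
  · rintro ⟨-, hk', h1, h2⟩
    exact ⟨union_subset (hZ.trans sdiff_subset) (sdiff_subset.trans hL.subset_gr), by omega, h1, h2⟩

/-- **The low fibre**: the bi-independent `k`-sets of `N` with trace `T₀` on `L` are, by `X ↦ X ∖ L`, the
bi-independent `(k−s)`-sets of `M(T₀, f)` avoiding `f`. -/
theorem card_filter_biIndepSets_odd_low (hL : OddRestriction N L s) {T₀ : Finset α} (hT₀ : T₀ ∈ L.powersetCard s)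
    {f : α} (hfL : f ∈ L) (hfT : f ∉ T₀) {k : ℕ} (hk : s ≤ k) :
    ((biIndepSets N k).filter (fun X => X ∩ L = T₀)).card =
      ((biIndepSets (oddMinor N L T₀ f) (k - s)).filter (fun Z => f ∉ Z)).card := by
  obtain ⟨hT₀L, hT₀c⟩ := mem_powersetCard.1 hT₀
  have hgr := gr_oddMinor (N := N) hT₀L hfT
  apply card_bij (fun X _ => X \ L)
  · intro X hX
    rw [mem_filter] at hX ⊢
    obtain ⟨hX, hXL⟩ := hX
    have hZ : X \ L ⊆ gr N \ L := sdiff_subset_sdiff (mem_biIndepSets.1 hX).1 (subset_refl L)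
    refine ⟨?_, fun h => (mem_sdiff.1 h).2 hfL⟩
    rw [← union_mem_biIndepSets_odd_low_iff hL hT₀ hfL hfT hk hZ, ← hXL, sdiff_union_inter]
    exact hX
  · intro X hX Y hY h
    rw [mem_filter] at hX hY
    rw [← sdiff_union_inter X L, ← sdiff_union_inter Y L, h, hX.2, hY.2]
  · intro Z hZ
    rw [mem_filter] at hZ
    obtain ⟨hZ, hfZ⟩ := hZ
    have hZg : Z ⊆ gr N \ L := by
      intro x hx
      have := (mem_biIndepSets.1 hZ).1 hx
      rw [hgr, mem_sdiff] at this
      exact mem_sdiff.2 ⟨this.1, fun hxL => this.2 (mem_erase.2 ⟨fun h => hfZ (h ▸ hx), hxL⟩)⟩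
    have hZL : Disjoint Z L := disjoint_left.2 (fun x hx hxL => (mem_sdiff.1 (hZg hx)).2 hxL)
    refine ⟨Z ∪ T₀, ?_, ?_⟩
    · rw [mem_filter, union_mem_biIndepSets_odd_low_iff hL hT₀ hfL hfT hk hZg]
      refine ⟨hZ, ?_⟩
      rw [union_inter_distrib_right, disjoint_iff_inter_eq_empty.1 hZL, empty_union, inter_eq_left.2 hT₀L]
    · ext x
      simp only [mem_sdiff, mem_union]
      constructor
      · rintro ⟨hx | hx, hxL⟩
        · exact hx
        · exact absurd (hT₀L hx) hxL
      · intro hx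
        exact ⟨Or.inl hx, disjoint_left.1 hZL hx⟩

/-- **The high fibre**: the bi-independent `k`-sets of `N` with trace `L ∖ T₀` on `L` are, by `X ↦ (X ∖ L) ∪ {f}`, the
bi-independent `(k−s)`-sets of `M(T₀, f)` through `f`. -/
theorem card_filter_biIndepSets_odd_high (hL : OddRestriction N L s) {T₀ : Finset α} (hT₀ : T₀ ∈ L.powersetCard s)
    {f : α} (hfL : f ∈ L) (hfT : f ∉ T₀) {k : ℕ} (hk : s ≤ k) :
    ((biIndepSets N k).filter (fun X => X ∩ L = L \ T₀)).card =
      ((biIndepSets (oddMinor N L T₀ f) (k - s)).filter (fun Z => f ∈ Z)).card := by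
  obtain ⟨hT₀L, hT₀c⟩ := mem_powersetCard.1 hT₀
  have hgr := gr_oddMinor (N := N) hT₀L hfT
  apply card_bij (fun X _ => insert f (X \ L))
  · intro X hX
    rw [mem_filter] at hX ⊢
    obtain ⟨hX, hXL⟩ := hX
    have hZ : X \ L ⊆ gr N \ L := sdiff_subset_sdiff (mem_biIndepSets.1 hX).1 (subset_refl L)
    refine ⟨?_, mem_insert_self f _⟩
    rw [← union_mem_biIndepSets_odd_high_iff hL hT₀ hfL hfT hk hZ, ← hXL, sdiff_union_inter]
    exact hX
  · intro X hX Y hY h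
    rw [mem_filter] at hX hY
    have hfX : f ∉ X \ L := fun h' => (mem_sdiff.1 h').2 hfL
    have hfY : f ∉ Y \ L := fun h' => (mem_sdiff.1 h').2 hfL
    have h' : X \ L = Y \ L := by
      rw [← erase_insert hfX, ← erase_insert hfY, h]
    rw [← sdiff_union_inter X L, ← sdiff_union_inter Y L, h', hX.2, hY.2]
  · intro Z' hZ'
    rw [mem_filter] at hZ'
    obtain ⟨hZ', hfZ'⟩ := hZ'
    set Z := Z'.erase f with hZdef
    have hZ'e : Z' = insert f Z := (insert_erase hfZ').symm
    have hfZ : f ∉ Z := notMem_erase f Z'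
    have hZg : Z ⊆ gr N \ L := by
      intro x hx
      have hxZ' : x ∈ Z' := mem_of_mem_erase hx
      have := (mem_biIndepSets.1 hZ').1 hxZ'
      rw [hgr, mem_sdiff] at this
      exact mem_sdiff.2 ⟨this.1, fun hxL => this.2 (mem_erase.2 ⟨fun h => hfZ (h ▸ hx), hxL⟩)⟩
    have hZL : Disjoint Z L := disjoint_left.2 (fun x hx hxL => (mem_sdiff.1 (hZg hx)).2 hxL)
    refine ⟨Z ∪ (L \ T₀), ?_, ?_⟩
    · rw [mem_filter, union_mem_biIndepSets_odd_high_iff hL hT₀ hfL hfT hk hZg, ← hZ'e]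
      refine ⟨hZ', ?_⟩
      rw [union_inter_distrib_right, disjoint_iff_inter_eq_empty.1 hZL, empty_union, inter_eq_left.2 sdiff_subset]
    · have e1 : (Z ∪ (L \ T₀)) \ L = Z := by
        ext x
        simp only [mem_sdiff, mem_union]
        constructor
        · rintro ⟨hx | hx, hxL⟩
          · exact hx
          · exact absurd hx.1 hxL
        · intro hx
          exact ⟨Or.inl hx, disjoint_left.1 hZL hx⟩
      rw [e1, ← hZ'e]

end odd

end PercRepro.Cogirth
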